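import Literature.NumberTheory.EllipticCurves.UnramifiedFourTorsionGoodReduction
import Literature.NumberTheory.EllipticCurves.GoodReductionUnramifiedDescent
import Literature.NumberTheory.EllipticCurves.HasseWeilAbelianPotentialGoodReductionProofs
import Literature.NumberTheory.EllipticCurves.NeronOggShafarevichLocal
import Literature.NumberTheory.EllipticCurves.SwanConductorTorsionProofs
import Literature.NumberTheory.GaloisRepresentations.GaloisCohomologyInfResProofs
import HarnessLib

/-!
# Potential good reduction at the places not above `2` (Silverman *AEC* Prop. VII.5.5 via
# Prop. IV.10.3(b) of *ATAEC*: good reduction over `K(E[4])`), proofs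

`Proofs` file (theorems only: no definitions, no named facts, no instances) in topic
`NumberTheory/EllipticCurves`, landed by the tenured seat of the named fact
`Literature.NumberTheory.Automorphic.BCDT.CDT_theorem_7_2_4` (Conrad–Diamond–Taylor 1999,
Thm. 7.2.4) as a bottom-up step under the Galois-side input of that theorem at the place `3`
(see `TateModuleWildKernelProofs` of the same seat for the context: the zero form of Ogg's
formula at `p = 3` needs the independence of `ℓ` of the tameness of `V_ℓ E`, which needs potential
good reduction **at residue characteristic `3`** in Galois form).

The tree proves "integral `j` ⇒ potential good reduction" (Silverman, *The Arithmetic of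
Elliptic Curves*, Prop. VII.5.5) only at the places `v ∤ 6`, over the Kummer extension
`K(¹²√Δ)` (`HasseWeilAbelianPotentialGoodReductionProofs`:
`exists_normal_hasGoodReductionAt_baseChange_of_valuation_j_le_one`,
`exists_normal_smul_torsion_eq_self_of_valuation_j_le_one_of_notMem`; its docstring: *"At
`p = 2, 3` potential good reduction needs wild extensions such as `K(E[3])`, `K(E[4])`; that part
remains open"*).  This file proves it at **every place `v ∤ 2`** (so at `p = 3`), over a finite
Galois extension `F ⊇ K(E[4])`, following *ATAEC* Prop. IV.10.3(b) (*"Let `m ≥ 3` be an integer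
relatively prime to `p`. Then `E` has good reduction over `K(E[m])`"*, PDF p. 360) with `m = 4`,
whose local content — unramified `E[4]` and integral `j` give a good equation over `K_v^nr`, by the
Legendre form — is the tree's theorem
`WeierstrassCurve.exists_variableChange_inertia_or_one_lt_j_of_four_torsion`
(`UnramifiedFourTorsionGoodReduction`; Silverman *AEC* proofs of Prop. VII.5.4(c), VII.5.5), and
whose descent from `K_v^nr` to `K_v` is the tree's
`WeierstrassCurve.hasGoodReductionAt_of_variableChange_inertia` (`GoodReductionUnramifiedDescent`).

## Main results

* `WeierstrassCurve.exists_isGalois_forall_smul_geomTorsion_eq` — a finite Galois `F/K` inside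
  `K̄` over which `E[m]` becomes rational (`Γ_K` acts on `E[m]` through `Gal(F/K)`; e.g.
  `F ⊇ K(E[m])`);
* `WeierstrassCurve.hasGoodReductionAt_of_forall_smul_four_torsion_eq` — **over any number field:
  if all of `E[4]` is rational, then `E` has good reduction at every place `v ∤ 2` of integral
  `j`** (*ATAEC* Prop. IV.10.3 (iii) ⇒ (i) with `m = 4`, globally);
* `WeierstrassCurve.exists_isGalois_hasGoodReductionAt_baseChange_of_valuation_j_le_one_of_notMem_two`
  — **Prop. VII.5.5 at `v ∤ 2`**: for `ord_v(j) ≥ 0`, `2 ∉ v`, there is a finite Galois `F/K`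
  inside `K̄` over which the curve has good reduction at every place above `v`
  (*ATAEC* Prop. IV.10.3(b), `m = 4`);
* `WeierstrassCurve.exists_normal_smul_torsion_eq_self_of_valuation_j_le_one_of_notMem_two` —
  **the Galois form** (the shape of `…_of_notMem` of `HasseWeilAbelianPotentialGoodReductionProofs`,
  now at every `v ∤ 2`): a finite normal `F/K` inside `K̄` such that every `σ ∈ I_𝔓` restricting
  trivially to `F` fixes every `E[m']`, `v ∤ m'` (*AEC* VII.4.1(a) over `F`,
  `smul_eq_of_mem_inertia_of_forall_smul_eq_of_nsmul_eq_zero`).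

## References

* J. H. Silverman, *Advanced Topics in the Arithmetic of Elliptic Curves*, GTM 151 (1994),
  Prop. IV.10.3 and its proof (PDF pp. 360–361). [SilvermanATAEC1994]
* J. H. Silverman, *The Arithmetic of Elliptic Curves*, 2nd ed. (2009), Prop. VII.4.1,
  Prop. VII.5.4(c), Prop. VII.5.5, Cor. III.6.4. [SilvermanAEC2009]
* J.-P. Serre, J. Tate, *Good reduction of abelian varieties*, Ann. of Math. 88 (1968), §1–2.
  [SerreTate1968]

## Design

Theorems only; `noncomputable section`; one universe `u`.  Namespace `WeierstrassCurve`
(deliberate dot-notation extensions, companions of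
`exists_normal_hasGoodReductionAt_baseChange_of_valuation_j_le_one`).  No instances, no `sorry`;
axioms of every theorem: `propext`, `Classical.choice`, `Quot.sound`.
-/

noncomputable section

open scoped Classical NumberField NNReal
open scoped AddSubgroup
open Field IsDedekindDomain

universe u

namespace Literature.NumberTheory.GaloisRepresentations

/-- The elements of `Γ_K` coming from `Γ_F` (`absGaloisRestrict K F`, `F/K` normal inside `K̄`)
restrict trivially to `F` (`absGaloisRestrict_mem_absGaloisFixingSubgroup`: the image of
`Γ_F → Γ_K` is `Gal(K̄/F)`, the kernel of `Γ_K → Gal(F/K)`). [folklore] -/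
theorem absRestrictNormalHom_absGaloisRestrict_eq_one {K : Type u} [Field K]
    (F : IntermediateField K (AlgebraicClosure K)) [Normal K F] (γ : absoluteGaloisGroup F) :
    absRestrictNormalHom F (absGaloisRestrict K F γ) = 1 :=
  (MonoidHom.mem_ker).mp (absGaloisRestrict_mem_absGaloisFixingSubgroup K F γ)

end Literature.NumberTheory.GaloisRepresentations

namespace WeierstrassCurve

open Literature.NumberTheory.EllipticCurves Literature.NumberTheory.GaloisRepresentations
  IsDedekindDomain.HeightOneSpectrum

/-! ### A finite Galois extension over which `E[m]` becomes rational -/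

section TorsionField

variable {K : Type u} [Field K] (W : WeierstrassCurve K)

/-- **A finite Galois `F/K` inside `K̄` over which `E[m]` becomes rational** (`m ≠ 0`): the action
of `Γ_K` on `E[m]` factors through `Gal(F/K)`, i.e. every `σ` restricting trivially to `F` fixes
`E[m]` pointwise.  The mod-`m` representation into the finite discrete group `Aut E[m]` is
continuous (its kernel contains the open pointwise fixer of the finite set `E[m]`,
`isOpen_stabilizer_point_holds`), so it factors through a finite Galois group
(`exists_isGalois_ker_le`).  Any `F` containing the field `K(E[m])` of the book (Silverman
*ATAEC* §IV.10, `L = K(E[ℓ])`, PDF p. 358; Prop. IV.10.3(b), `K(E[m])`) will do.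
[cite: SilvermanATAEC1994, §IV.10 (the fields K(E[ℓ]), K(E[m]), PDF pp. 358–360)] -/
theorem exists_isGalois_forall_smul_geomTorsion_eq [W.IsElliptic] {m : ℕ} (hm : m ≠ 0) :
    ∃ (F : IntermediateField K (AlgebraicClosure K)) (_ : FiniteDimensional K F) (_ : IsGalois K F),
      ∀ σ : absoluteGaloisGroup K, absRestrictNormalHom F σ = 1 →
        ∀ P : geomTorsion W m, σ • P = P := by
  let X := (geomPoints W)[(m : ℕ)]
  haveI : Finite X := W.finite_geomTorsion_nat hm
  let Hd := Multiplicative (AddAut X)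
  letI : TopologicalSpace Hd := ⊥
  haveI : DiscreteTopology Hd := ⟨rfl⟩
  let f₀ : absoluteGaloisGroup K →* Hd := DistribMulAction.toAddAut (absoluteGaloisGroup K) X
  -- the kernel of `f₀` is open: it contains the pointwise fixer of the finite set `E[m]`
  have hker : IsOpen ((f₀.ker : Subgroup (absoluteGaloisGroup K)) : Set (absoluteGaloisGroup K)) := by
    refine Subgroup.isOpen_mono
      (H₁ := ⨅ P : X, MulAction.stabilizer (absoluteGaloisGroup K) (P : geomPoints W)) ?_ ?_
    · intro τ hτ
      rw [MonoidHom.mem_ker]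
      apply Multiplicative.toAdd.injective
      refine AddEquiv.ext fun z ↦ Subtype.ext ?_
      exact (Subgroup.mem_iInf.mp hτ) z
    · rw [Subgroup.coe_iInf]
      exact isOpen_iInter_of_finite fun P ↦ isOpen_stabilizer_point_holds W (P : geomPoints W)
  have hcont : Continuous f₀ := by
    refine continuous_def.mpr fun s _ ↦ ?_
    have hs : f₀ ⁻¹' s =
        ⋃ τ ∈ f₀ ⁻¹' s, (fun κ ↦ τ * κ) '' (f₀.ker : Set (absoluteGaloisGroup K)) := by
      ext τ
      simp only [Set.mem_preimage, Set.mem_iUnion, Set.mem_image, SetLike.mem_coe,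
        MonoidHom.mem_ker]
      constructor
      · intro hτ
        exact ⟨τ, hτ, 1, map_one f₀, mul_one τ⟩
      · rintro ⟨τ', hτ', κ, hκ, rfl⟩
        rw [map_mul, hκ, mul_one]
        exact hτ'
    rw [hs]
    exact isOpen_biUnion fun τ _ ↦ (isOpenMap_mul_left τ) _ hker
  let f : absoluteGaloisGroup K →ₜ* Hd := ⟨f₀, hcont⟩
  obtain ⟨F, hfin, hgal, hkerF⟩ := exists_isGalois_ker_le K f
  refine ⟨F, hfin, hgal, fun σ hσ P ↦ ?_⟩
  have h1 : f₀ σ = 1 := by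
    have := hkerF (show σ ∈ (absRestrictNormalHom F).ker from hσ)
    rwa [MonoidHom.mem_ker] at this
  exact AddEquiv.congr_fun (Multiplicative.toAdd.injective.eq_iff.mpr h1 :
    Multiplicative.toAdd (f₀ σ) = Multiplicative.toAdd 1) P

end TorsionField

/-! ### Rational `E[4]` and integral `j` give good reduction at the places not above `2` -/

section FourTorsion

variable {K : Type u} [Field K] [NumberField K] (W : WeierstrassCurve K)

/-- **Silverman *ATAEC* Prop. IV.10.3, (iii) ⇒ (i) with `m = 4`, over a number field.**  Let
`E/K` be an elliptic curve over a number field all of whose `4`-torsion points in `E(K̄)` are fixed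
by `Γ_K` (i.e. `E[4] ⊆ E(K)`), and `v` a finite place with `2 ∉ v` and `ord_v(j(E)) ≥ 0`
(`v.valuation K W.j ≤ 1`).  Then `E` has good reduction at `v`.  The local inertia group
`I_𝔐 ≤ Γ_{K_v}` fixes the `4`-torsion of `E(K̄_v)` (every such point comes from `E(K̄)`,
`exists_pointsMapOfEmb_eq_of_nsmul_eq_zero`, equivariantly, `pointsMapOfEmb_smul`), so by the
tree's Legendre-form theorem `exists_variableChange_inertia_or_one_lt_j_of_four_torsion`
(`UnramifiedFourTorsionGoodReduction`: *AEC* proofs of VII.5.4(c), VII.5.5) either some change of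
variables defined over `K_v^nr` makes `E` integral with unit discriminant — whence good reduction
at `v` by `hasGoodReductionAt_of_variableChange_inertia` (`GoodReductionUnramifiedDescent`,
*AEC* VII.5.4(a)) — or `|j|_v > 1`, excluded by the integrality of `j`
(`spectralValuation_algebraMap_le_one_iff`).
[cite: SilvermanATAEC1994, Prop. IV.10.3 (PDF pp. 360–361)]
[cite: SilvermanAEC2009, Prop. VII.5.4(c) and Prop. VII.5.5 (proofs, Legendre form)] -/
theorem hasGoodReductionAt_of_forall_smul_four_torsion_eq [W.IsElliptic]
    (hfix4 : ∀ (σ : absoluteGaloisGroup K) (P : geomPoints W), 4 • P = 0 → σ • P = P)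
    {v : HeightOneSpectrum (𝓞 K)} (h2 : (2 : 𝓞 K) ∉ v.asIdeal) (hj : v.valuation K W.j ≤ 1) :
    W.HasGoodReductionAt v := by
  obtain ⟨w, hw⟩ := v.exists_spectralValuation
  obtain ⟨𝔐, h𝔐⟩ := v.localPrimesAbove_nonempty
  set ι : AlgebraicClosure K →ₐ[K] AlgebraicClosure (v.adicCompletion K) :=
    closureEmb (K := K) (v.adicCompletion K) with hι
  -- the local inertia group fixes the `4`-torsion of `E(K̄_v)`
  have hfix : ∀ σ ∈ 𝔐.inertia (absoluteGaloisGroup (v.adicCompletion K)),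
      ∀ P : localPoints W (v.adicCompletion K), 4 • P = 0 → σ • P = P := by
    intro σ _ Q hQ
    obtain ⟨P, hP, rfl⟩ := exists_pointsMapOfEmb_eq_of_nsmul_eq_zero W ι four_ne_zero hQ
    rw [← pointsMapOfEmb_smul, hfix4 _ P hP]
  rcases W.exists_variableChange_inertia_or_one_lt_j_of_four_torsion hw h2 hfix with
    ⟨C, hC, hint, hΔ⟩ | hlt
  · exact hasGoodReductionAt_of_variableChange_inertia hw W h𝔐 C hC hint hΔ
  · -- `|j|_v > 1` contradicts `ord_v(j) ≥ 0`
    exfalso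
    rw [IsScalarTower.algebraMap_apply K (v.adicCompletion K)
      (AlgebraicClosure (v.adicCompletion K)) W.j, ← not_le,
      spectralValuation_algebraMap_le_one_iff hw] at hlt
    apply hlt
    rw [mem_adicCompletionIntegers]
    change Valued.v ((W.j : K) : v.adicCompletion K) ≤ 1
    rw [valuedAdicCompletion_eq_valuation']
    exact hj

end FourTorsion

/-! ### Prop. VII.5.5 at the places not above `2`: good reduction over `F ⊇ K(E[4])` -/

section PotentialGoodReduction

variable {K : Type u} [Field K] [NumberField K] (W : WeierstrassCurve K)

/-- **Over a finite Galois `F/K` over which `E[4]` is rational, `E` has good reduction at every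
place `w ∣ v` of `F`, for `v ∤ 2` of integral `j`** (Silverman *ATAEC* Prop. IV.10.3(b) with
`m = 4`: *"Then `E` has good reduction over `K(E[m])`"*).  Every `4`-torsion point of `E_F(F̄)`
comes from `E(K̄)` (`exists_pointsMapOfEmb_eq_of_nsmul_eq_zero`, `localPointsEquivGeomPoints`) and
is therefore fixed by `Γ_F`, whose image in `Γ_K` restricts trivially to `F`
(`absRestrictNormalHom_absGaloisRestrict_eq_one`,
`localPointsEquivGeomPoints_pointsMapOfEmb_smul`); `ord_w(j) ≥ 0` (Mathlib `valuation_liesOver`);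
so `hasGoodReductionAt_of_forall_smul_four_torsion_eq` applies to `E_F` at `w`.
[cite: SilvermanATAEC1994, Prop. IV.10.3(b) (PDF p. 360)] -/
theorem hasGoodReductionAt_baseChange_of_forall_smul_geomTorsion_four_eq [W.IsElliptic]
    (F : IntermediateField K (AlgebraicClosure K)) [FiniteDimensional K F] [Normal K F]
    [NumberField F]
    (hF : ∀ σ : absoluteGaloisGroup K, absRestrictNormalHom F σ = 1 →
      ∀ P : geomTorsion W (4 : ℕ), σ • P = P)
    {v : HeightOneSpectrum (𝓞 K)} (h2 : (2 : 𝓞 K) ∉ v.asIdeal) (hj : v.valuation K W.j ≤ 1)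
    {w : HeightOneSpectrum (𝓞 F)} (hw : w.asIdeal.under (𝓞 K) = v.asIdeal) :
    (W.baseChange F).HasGoodReductionAt w := by
  haveI : w.asIdeal.LiesOver v.asIdeal := ⟨hw.symm⟩
  haveI : (W.baseChange F).IsElliptic := inferInstanceAs (W.map (algebraMap K F)).IsElliptic
  have h2w : (2 : 𝓞 F) ∉ w.asIdeal := by
    simpa using natCast_notMem_of_under_eq (K := K) hw (q := 2) (by simpa using h2)
  have hjw : w.valuation F (W.baseChange F).j ≤ 1 := by
    rw [show (W.baseChange F).j = algebraMap K F W.j from W.map_j (algebraMap K F),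
      ← HeightOneSpectrum.valuation_liesOver F v w]
    exact pow_le_one₀ zero_le hj
  refine (W.baseChange F).hasGoodReductionAt_of_forall_smul_four_torsion_eq ?_ h2w hjw
  -- `Γ_F` fixes the `4`-torsion of `E_F(F̄)`
  intro γ Q hQ
  obtain ⟨Q₁, rfl⟩ := (localPointsEquivGeomPoints W F).surjective Q
  have hQ₁ : (4 : ℕ) • Q₁ = 0 := by
    apply (localPointsEquivGeomPoints W F).injective
    rw [map_nsmul, hQ, map_zero]
  obtain ⟨R, hR, rfl⟩ :=
    exists_pointsMapOfEmb_eq_of_nsmul_eq_zero W (absClosureEmbedding K F) four_ne_zero hQ₁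
  rw [← localPointsEquivGeomPoints_pointsMapOfEmb_smul]
  congr 2
  have hR' : R ∈ geomTorsion W (4 : ℕ) :=
    (Submodule.mem_torsionBy_iff _ _).mpr (by rw [natCast_zsmul]; exact_mod_cast hR)
  exact congrArg Subtype.val
    (hF _ (absRestrictNormalHom_absGaloisRestrict_eq_one F γ) ⟨R, hR'⟩)

/-- **Silverman *AEC* Prop. VII.5.5 ("integral `j` ⇒ potential good reduction") at the places
`v ∤ 2`, through *ATAEC* Prop. IV.10.3(b) with `m = 4`.**  For an elliptic curve `E/K` over a
number field and a finite place `v` with `2 ∉ v` and `ord_v(j) ≥ 0` there is a finite Galois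
`F/K` inside `K̄` — any finite Galois `F ⊇ K(E[4])`, `exists_isGalois_forall_smul_geomTorsion_eq` —
over which `E` has good reduction at every place above `v`
(`hasGoodReductionAt_baseChange_of_forall_smul_geomTorsion_four_eq`).  Companion at `p = 3` (and
`p ≥ 5`) of `exists_normal_hasGoodReductionAt_baseChange_of_valuation_j_le_one`
(`HasseWeilAbelianPotentialGoodReductionProofs`, `v ∤ 6`, over `K(¹²√Δ)`).
[cite: SilvermanAEC2009, Prop. VII.5.5] [cite: SilvermanATAEC1994, Prop. IV.10.3(b) (PDF p. 360)] -/
theorem exists_isGalois_hasGoodReductionAt_baseChange_of_valuation_j_le_one_of_notMem_two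
    [W.IsElliptic] (v : HeightOneSpectrum (𝓞 K)) (hj : v.valuation K W.j ≤ 1)
    (h2 : (2 : 𝓞 K) ∉ v.asIdeal) :
    ∃ (F : IntermediateField K (AlgebraicClosure K)) (_ : FiniteDimensional K F) (_ : IsGalois K F)
      (_ : NumberField F),
      ∀ w : HeightOneSpectrum (𝓞 F), w.asIdeal.under (𝓞 K) = v.asIdeal →
        (W.baseChange F).HasGoodReductionAt w := by
  obtain ⟨F, hfin, hgal, hF⟩ := W.exists_isGalois_forall_smul_geomTorsion_eq (m := 4) four_ne_zero
  haveI := hfin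
  haveI := hgal
  haveI : NumberField F := NumberField.of_module_finite K F
  exact ⟨F, hfin, hgal, inferInstance, fun w hw ↦
    W.hasGoodReductionAt_baseChange_of_forall_smul_geomTorsion_four_eq F hF h2 hj hw⟩

/-- **Potential good reduction for integral `j`, Galois form, at the places `v ∤ 2`** (Silverman
*AEC* Prop. VII.5.5 with Prop. VII.4.1(a)): for `ord_v(j) ≥ 0` and `2 ∉ v` there is a finite
normal `F/K` inside `K̄` (any finite Galois `F ⊇ K(E[4])`) such that every `σ ∈ I_𝔓`, `𝔓 ∣ v`,
restricting trivially to `F` fixes every `E[m']`, `v ∤ m'` — the inertia group of `F` at `𝔓` acts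
trivially on the prime-to-`v` torsion because `E_F` has good reduction above `v`
(`smul_eq_of_mem_inertia_of_forall_smul_eq_of_nsmul_eq_zero`, `PotentialGoodReductionInertiaProofs`).
This is the statement `exists_normal_smul_torsion_eq_self_of_valuation_j_le_one_of_notMem` of
`HasseWeilAbelianPotentialGoodReductionProofs` (there `v ∤ 6`) at every place not above `2`, in
particular at residue characteristic `3`.
[cite: SilvermanAEC2009, Prop. VII.5.5 with Prop. VII.4.1(a)]
[cite: SilvermanATAEC1994, Prop. IV.10.3(b) (PDF p. 360)] -/
theorem exists_normal_smul_torsion_eq_self_of_valuation_j_le_one_of_notMem_two [W.IsElliptic]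
    (v : HeightOneSpectrum (𝓞 K)) (hj : v.valuation K W.j ≤ 1) (h2 : (2 : 𝓞 K) ∉ v.asIdeal)
    {𝔓 : Ideal (absIntegers (𝓞 K) K)} (h𝔓 : 𝔓 ∈ v.primesAbove) :
    ∃ (F : IntermediateField K (AlgebraicClosure K)) (_ : FiniteDimensional K F) (_ : Normal K F),
      ∀ {σ : absoluteGaloisGroup K} (_hσI : σ ∈ 𝔓.inertia (absoluteGaloisGroup K))
        (_hσF : σ ∈ (absRestrictNormalHom F).ker)
        {m' : ℕ} (_hm' : (m' : 𝓞 K) ∉ v.asIdeal) (P : geomPoints W), m' • P = 0 → σ • P = P := by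
  obtain ⟨F, hfin, hgal, hNF, hgood⟩ :=
    W.exists_isGalois_hasGoodReductionAt_baseChange_of_valuation_j_le_one_of_notMem_two v hj h2
  haveI := hfin
  haveI := hgal
  haveI := hNF
  refine ⟨F, hfin, inferInstance, fun {σ} hσI hσF {m'} hm' P hP ↦ ?_⟩
  -- `σ` fixes `F` pointwise
  have hfix : ∀ x : AlgebraicClosure K, x ∈ F → σ • x = x := by
    intro x hx
    have hcomm := AlgEquiv.restrictNormal_commutes (absoluteGaloisGroup.toAlgEquiv K σ) F ⟨x, hx⟩
    have hres : (absoluteGaloisGroup.toAlgEquiv K σ).restrictNormal F = absRestrictNormalHom F σ :=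
      rfl
    rw [hres, (MonoidHom.mem_ker).mp hσF, AlgEquiv.one_apply] at hcomm
    rw [absoluteGaloisGroup.smul_def]
    exact hcomm.symm
  exact W.smul_eq_of_mem_inertia_of_forall_smul_eq_of_nsmul_eq_zero F hgood hm' h𝔓 hσI hfix hP

end PotentialGoodReduction

end WeierstrassCurve

end
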